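import Summits.MatrixMultiplication.OmegaCensus.SmallFormats.KroneckerChains

/-!
# Kronecker modules III: Wong sequences and the regular/nilpotent candidates

Cell `pub-omega` (unit `pub-omega-tensor-g33`), topic `Summits/MatrixMultiplication/OmegaCensus` (sub-folder `SmallFormats`).
Framing (verbatim): lottery ticket; floor = certified bounds/negative ranges. HONEST FRAMING: general linear algebra toward
PROVING `KroneckerBlockForm97`; nothing on `ω` here.

For a Kronecker module `a b : U →ₗ[k] V` the *Wong sequences* are `X 0 = ⊤`, `X (n+1) = a⁻¹(b (X n))` (decreasing) and
`Y 0 = ⊥`, `Y (n+1) = b⁻¹(a (Y n))` (increasing) (Wong 1974; Berger–Ilchmann–Trenn 2012, here basis-free and over any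
field). Both are stable from the index `finrank U` on (`Xi`, `Yi`). On a direct sum of Kronecker blocks, `Xi` is the sum of the
`L_ηᵀ` and companion (finite-eigenvalue) parts and `Yi` the sum of the `L_ηᵀ` and `N` (infinite-eigenvalue) parts. This file
proves the half of the quasi-Weierstraß decomposition that needs only CHAIN-FREENESS of the module (no `L_ηᵀ` blocks):
`b` is injective on `Xi`, `a` is injective on `Yi`, `Xi ⊓ Yi = ⊥`, `b Xi ⊓ a Yi = ⊥` — each by the dimension count of
`KroneckerChains` on an invariant pair. The other half (`Xi ⊔ Yi = ⊤`, `b Xi ⊔ a Yi = ⊤`) needs chain-freeness of the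
DUAL module and is `KroneckerDual`.
-/

namespace Summit.MatrixMultiplication.OmegaCensus.SmallFormats.Kronecker

open Module Submodule

variable {k : Type*} [Field k] {U V : Type*} [AddCommGroup U] [Module k U] [AddCommGroup V] [Module k V]

/-! ## Stabilization of monotone / antitone sequences of subspaces -/

/-- An antitone sequence of subspaces whose equalities propagate is stable from the index `finrank U` on. -/
theorem stable_of_antitone [FiniteDimensional k U] (f : ℕ → Submodule k U) (hanti : ∀ n, f (n + 1) ≤ f n)
    (hprop : ∀ n, f n = f (n + 1) → f (n + 1) = f (n + 1 + 1)) : f (finrank k U) = f (finrank k U + 1) := by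
  by_contra hne
  set d := finrank k U
  -- no equality below d
  have hne' : ∀ n ≤ d, f n ≠ f (n + 1) := by
    intro n hn heq
    have : ∀ j, f (n + j) = f (n + j + 1) := by
      intro j
      induction j with
      | zero => simpa using heq
      | succ j ih => simpa [Nat.add_assoc] using hprop (n + j) ih
    exact hne (by simpa [Nat.add_sub_cancel' hn] using this (d - n))
  have hlt : ∀ n ≤ d, finrank k (f (n + 1)) < finrank k (f n) := fun n hn =>
    Submodule.finrank_lt_finrank_of_lt (lt_of_le_of_ne (hanti n) (hne' n hn).symm)
  have hcount : ∀ n ≤ d + 1, finrank k (f n) + n ≤ finrank k (f 0) := by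
    intro n
    induction n with
    | zero => simp
    | succ n ih => intro hn; have := ih (by omega); have := hlt n (by omega); omega
  have h1 := hcount (d + 1) le_rfl
  have h2 : finrank k (f 0) ≤ d := Submodule.finrank_le _
  omega

/-- A monotone sequence of subspaces whose equalities propagate is stable from the index `finrank U` on. -/
theorem stable_of_monotone [FiniteDimensional k U] (f : ℕ → Submodule k U) (hmono : ∀ n, f n ≤ f (n + 1))
    (hprop : ∀ n, f n = f (n + 1) → f (n + 1) = f (n + 1 + 1)) : f (finrank k U) = f (finrank k U + 1) := by
  by_contra hne
  set d := finrank k U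
  have hne' : ∀ n ≤ d, f n ≠ f (n + 1) := by
    intro n hn heq
    have : ∀ j, f (n + j) = f (n + j + 1) := by
      intro j
      induction j with
      | zero => simpa using heq
      | succ j ih => simpa [Nat.add_assoc] using hprop (n + j) ih
    exact hne (by simpa [Nat.add_sub_cancel' hn] using this (d - n))
  have hlt : ∀ n ≤ d, finrank k (f n) < finrank k (f (n + 1)) := fun n hn =>
    Submodule.finrank_lt_finrank_of_lt (lt_of_le_of_ne (hmono n) (hne' n hn))
  have hcount : ∀ n ≤ d + 1, n ≤ finrank k (f n) := by
    intro n
    induction n with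
    | zero => simp
    | succ n ih => intro hn; have := ih (by omega); have := hlt n (by omega); omega
  have h1 := hcount (d + 1) le_rfl
  have h2 : finrank k (f (d + 1)) ≤ d := Submodule.finrank_le _
  omega

/-! ## The Wong sequences -/

variable (a b : U →ₗ[k] V)

/-- First Wong sequence: `X 0 = ⊤`, `X (n+1) = a⁻¹(b (X n))`. -/
def X : ℕ → Submodule k U
  | 0 => ⊤
  | n + 1 => ((X n).map b).comap a

/-- Second Wong sequence: `Y 0 = ⊥`, `Y (n+1) = b⁻¹(a (Y n))`. -/
def Y : ℕ → Submodule k U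
  | 0 => ⊥
  | n + 1 => ((Y n).map a).comap b

/-- `X 0 = ⊤`. -/
@[simp] theorem X_zero : X a b 0 = ⊤ := rfl

/-- The recursion of `X`. -/
theorem X_succ (n : ℕ) : X a b (n + 1) = ((X a b n).map b).comap a := rfl

/-- `Y 0 = ⊥`. -/
@[simp] theorem Y_zero : Y a b 0 = ⊥ := rfl

/-- The recursion of `Y`. -/
theorem Y_succ (n : ℕ) : Y a b (n + 1) = ((Y a b n).map a).comap b := rfl

/-- `X` is decreasing. -/
theorem X_antitone : ∀ n, X a b (n + 1) ≤ X a b n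
  | 0 => le_top
  | n + 1 => by
      rw [X_succ, X_succ]
      exact Submodule.comap_mono (Submodule.map_mono (X_antitone n))

/-- `Y` is increasing. -/
theorem Y_monotone : ∀ n, Y a b n ≤ Y a b (n + 1)
  | 0 => bot_le
  | n + 1 => by
      rw [Y_succ, Y_succ]
      exact Submodule.comap_mono (Submodule.map_mono (Y_monotone n))

/-- The stable value `Xi = X (finrank U)` of the first Wong sequence. -/
noncomputable def Xi [FiniteDimensional k U] : Submodule k U := X a b (finrank k U)

/-- The stable value `Yi = Y (finrank U)` of the second Wong sequence. -/
noncomputable def Yi [FiniteDimensional k U] : Submodule k U := Y a b (finrank k U)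

variable [FiniteDimensional k U]

/-- `X` is stable from `finrank U` on. -/
theorem X_eq_Xi : ∀ n, finrank k U ≤ n → X a b n = Xi a b := by
  have hstab := stable_of_antitone (X a b) (X_antitone a b) (fun n h => by
    rw [X_succ a b (n + 1)]; conv_lhs => rw [X_succ a b n]
    rw [← h])
  intro n hn
  obtain ⟨j, rfl⟩ := Nat.exists_eq_add_of_le hn
  induction j with
  | zero => rfl
  | succ j ih =>
      have e1 : X a b (finrank k U + (j + 1)) = ((X a b (finrank k U + j)).map b).comap a := by
        rw [← Nat.add_assoc]; rfl
      rw [e1, ih (by omega)]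
      show X a b (finrank k U + 1) = X a b (finrank k U)
      exact hstab.symm

/-- `Y` is stable from `finrank U` on. -/
theorem Y_eq_Yi : ∀ n, finrank k U ≤ n → Y a b n = Yi a b := by
  have hstab := stable_of_monotone (Y a b) (Y_monotone a b) (fun n h => by
    rw [Y_succ a b (n + 1)]; conv_lhs => rw [Y_succ a b n]
    rw [← h])
  intro n hn
  obtain ⟨j, rfl⟩ := Nat.exists_eq_add_of_le hn
  induction j with
  | zero => rfl
  | succ j ih =>
      have e1 : Y a b (finrank k U + (j + 1)) = ((Y a b (finrank k U + j)).map a).comap b := by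
        rw [← Nat.add_assoc]; rfl
      rw [e1, ih (by omega)]
      show Y a b (finrank k U + 1) = Y a b (finrank k U)
      exact hstab.symm

/-- Fixed-point equation of `Xi`. -/
theorem Xi_eq : ((Xi a b).map b).comap a = Xi a b := by
  show X a b (finrank k U + 1) = Xi a b
  exact X_eq_Xi a b _ (Nat.le_succ _)

/-- Fixed-point equation of `Yi`. -/
theorem Yi_eq : ((Yi a b).map a).comap b = Yi a b := by
  show Y a b (finrank k U + 1) = Yi a b
  exact Y_eq_Yi a b _ (Nat.le_succ _)

/-- Every `Y n` lies in `Yi`. -/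
theorem Y_le_Yi (n : ℕ) : Y a b n ≤ Yi a b := by
  rcases Nat.lt_or_ge n (finrank k U) with h | h
  · obtain ⟨j, hj⟩ := Nat.exists_eq_add_of_le h.le
    rw [Yi, hj]
    clear hj h
    induction j with
    | zero => exact le_rfl
    | succ j ih => exact le_trans ih (by rw [← Nat.add_assoc]; exact Y_monotone a b _)
  · rw [Y_eq_Yi a b n h]

/-- `a Xi ⊆ b Xi` (from the fixed-point equation). -/
theorem a_mem_map_b_Xi {u : U} (hu : u ∈ Xi a b) : a u ∈ (Xi a b).map b := by
  rw [← Xi_eq a b] at hu; exact hu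

/-- `b Yi ⊆ a Yi` (from the fixed-point equation). -/
theorem b_mem_map_a_Yi {u : U} (hu : u ∈ Yi a b) : b u ∈ (Yi a b).map a := by
  rw [← Yi_eq a b] at hu; exact hu

/-- If `a y ∈ b Xi` then `y ∈ Xi`. -/
theorem mem_Xi_of_a_mem {y : U} (hy : a y ∈ (Xi a b).map b) : y ∈ Xi a b := by
  rw [← Xi_eq a b]; exact hy

/-! ## A nonzero kernel vector drops the dimension of the image -/

variable {a b}

/-- If a subspace `p` contains a nonzero vector of `ker f` then `finrank (f p) < finrank p`. -/
theorem finrank_map_lt_of_ker (f : U →ₗ[k] V) (p : Submodule k U) {u : U} (hu : u ∈ p) (hu0 : u ≠ 0) (hf : f u = 0) :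
    finrank k (p.map f) < finrank k p := by
  have h := LinearMap.finrank_range_add_finrank_ker (f.domRestrict p)
  rw [LinearMap.range_domRestrict] at h
  have hpos : 0 < finrank k (LinearMap.ker (f.domRestrict p)) := by
    rw [Module.finrank_pos_iff_exists_ne_zero]
    refine ⟨⟨⟨u, hu⟩, by simpa using hf⟩, fun h0 => hu0 ?_⟩
    have := congrArg (fun z : LinearMap.ker (f.domRestrict p) => ((z : p) : U)) h0
    simpa using this
  omega

/-! ## The chain-free half of the quasi-Weierstraß decomposition -/

variable [FiniteDimensional k V]

/-- **`b` is injective on `Xi`** in a chain-free module. -/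
theorem ChainFree.b_inj_Xi (hF : ChainFree a b) {u : U} (hu : u ∈ Xi a b) (hb : b u = 0) : u = 0 := by
  by_contra hu0
  have hle := hF.finrank_le (Us := Xi a b) (Vs := (Xi a b).map b) (fun u hu => a_mem_map_b_Xi a b hu)
    (fun u hu => Submodule.mem_map_of_mem hu)
  have hlt := finrank_map_lt_of_ker b (Xi a b) hu hu0 hb
  omega

/-- **`a` is injective on `Yi`** in a chain-free module. -/
theorem ChainFree.a_inj_Yi (hF : ChainFree a b) {u : U} (hu : u ∈ Yi a b) (ha : a u = 0) : u = 0 := by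
  by_contra hu0
  have hle := hF.finrank_le (Us := Yi a b) (Vs := (Yi a b).map a) (fun u hu => Submodule.mem_map_of_mem hu)
    (fun u hu => b_mem_map_a_Yi a b hu)
  have hlt := finrank_map_lt_of_ker a (Yi a b) hu hu0 ha
  omega

/-- **`Xi ⊓ Y n = ⊥`** in a chain-free module. -/
theorem ChainFree.Xi_inf_Y (hF : ChainFree a b) : ∀ n, ∀ u ∈ Xi a b, u ∈ Y a b n → u = 0
  | 0, u, _, hY => by simpa using hY
  | n + 1, u, hX, hY => by
      rw [Y_succ] at hY
      obtain ⟨y, hy, hyu⟩ := Submodule.mem_map.mp hY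
      have hyX : y ∈ Xi a b := mem_Xi_of_a_mem a b (by rw [hyu]; exact Submodule.mem_map_of_mem hX)
      have hy0 : y = 0 := ChainFree.Xi_inf_Y hF n y hyX hy
      rw [hy0, map_zero] at hyu
      exact hF.b_inj_Xi hX hyu.symm

/-- **`Xi ⊓ Yi = ⊥`** in a chain-free module. -/
theorem ChainFree.Xi_inf_Yi (hF : ChainFree a b) : Xi a b ⊓ Yi a b = ⊥ :=
  (Submodule.eq_bot_iff _).mpr fun u hu => hF.Xi_inf_Y _ u hu.1 hu.2

/-- **`b Xi ⊓ a Yi = ⊥`** in a chain-free module. -/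
theorem ChainFree.map_Xi_inf_map_Yi (hF : ChainFree a b) : (Xi a b).map b ⊓ (Yi a b).map a = ⊥ := by
  refine (Submodule.eq_bot_iff _).mpr fun v hv => ?_
  obtain ⟨hv1, hv2⟩ := Submodule.mem_inf.mp hv
  obtain ⟨y, hy, rfl⟩ := Submodule.mem_map.mp hv2
  have hyX : y ∈ Xi a b := mem_Xi_of_a_mem a b hv1
  have : y = 0 := hF.Xi_inf_Y _ y hyX hy
  rw [this, map_zero]

end Summit.MatrixMultiplication.OmegaCensus.SmallFormats.Kronecker
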